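import Summits.QuantumFields.YangMills.Theorems.UnitScaleTiltProp7CovariantCurlGaugeComparison
import HarnessLib

/-!
# Route `UnitScaleTilt`, crux K1 «MinimiserStabilityRegPr» (stmt-QuantumFields-19200), EX row `hGF` (curved member) — small members, exit (α)(b)
# «member ↦ nearest toron»: **THE TWO-BACKGROUND CURL COMPARISON LETTERS** — the stencil `(D¹_V − D¹_W)Y` for TWO backgrounds and its zeroth-order closeness
# `Σ_{posPlaq}‖((D¹_V − D¹_W)Y)(p)‖_F² ≤ 16δ²Σ_b‖Y_b‖_F²` on the adjacent-edge row `‖V(x,μ) − W(x,μ)‖ ≤ δ` (w7 g11's ✓`Prop7CovariantCurlGaugeComparison` is the case `W = 1`);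
# consumed by the two-background (L5a) Hessian rows of `Prop7TwoBackgroundHessianComparison`

Cell `ym3-torus` (HUMAN RULING D-0037: YM₃ on T³ is ladder rung R3 — NOT d = 4, NOT infinite volume, NOT a mass gap, NOT Clay).  Width seat `ym-ust-19200-w5` (gen 14);
offered 2026-08-30 03:17Z as the `Δ^η` third of the (α)(b) comparison rows (★★OWNER WORDS 79∕82: small-member exit (α)(a) + (α)(b); px10 g10 `LOCATE-SMALL-MEMBERS` §(iv)).
THEOREMS ONLY (0 `def`, 0 `sorry`); `--supports stmt-QuantumFields-19200 --as helper`, count-neutral.  HONEST LABEL: letters of a supplier row; nothing of the twisted coercivity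
(α)(a), the toron gauge (P3), `hT`, `hGF`, (3.49), EX or the crux is proved here.

THE MATHEMATICS ([Balaban1985BackgroundPropagators] (3.4) p. 391, covariance p. 393).  `((D¹_V − D¹_W)Y)(p_{μν}(x)) = (V(x,μ)ZV(x,μ)* − W(x,μ)ZW(x,μ)*) − (μ ↔ ν)`,
`Z = Y_ν(x + e_μ)`: ZEROTH order in `Y`; `VZV* − WZW* = (V − W)·ZV* + WZ·(V − W)*` gives `‖VZV* − WZW*‖_F² ≤ 4‖V − W‖²‖Z‖_F²` (both factors unitary); the plaquette∕bond
count of ✓`curlSq_sub_le` (each bond value is the adjacent slot of `d − 1 = 2` edges) then yields the closeness.  WHY THE GENERALITY MATTERS (the η-count): downstream the error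
is `c₀η⁻²·16δ²Σ‖Y‖² = 16(η⁻¹δ)²‖X̃‖²`, K-uniform exactly when the gauge brings `U₀` within `δ ≲ C·η` of `W` bondwise; at a small member (`2L^{m+n} < 2R′` coarse sites, no cube
partition) `W` is a TORON, not `1`, and the toron gauge must be η-relative on EVERY bond, wrap bonds included.

WHAT IS PROVED (ns `…Theorems.Prop7TwoBackgroundCurlComparison`): §1 ★`sum_normSq_conjAd_sub_conjAd_le` (`Σ|(VZV* − WZW*)_{jk}|² ≤ 4‖V − W‖²Σ|Z_{jk}|²`, `V W ∈ SU(2)`);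
§2 `curl_sub_curl_apply` (two-background stencil), ★★`curlSq_sub_curlSq_le` (closeness on the adjacent-edge row, any `W`).
HONEST SCOPE.  Stencil algebra and Frobenius bookkeeping; no estimate of Bałaban's is asserted beyond the cited tree theorems.

References: T. Bałaban, CMP **99** (1985) 389–434 [Balaban1985BackgroundPropagators] ((3.3)–(3.5) p.391, p.393); CMP **99** (1985) 75–102 [Balaban1985RegularSpaces]
(Lemma 1 (1.25) p.79); CMP **98** (1985) 17–51 [Balaban1985Averaging] ((18)–(20) p.21).
-/

set_option autoImplicit false

noncomputable section

open scoped Matrix.Norms.L2Operator BigOperators Matrix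

namespace Summit.QuantumFields.YangMills.Theorems.Prop7TwoBackgroundCurlComparison

open Literature.MathematicalPhysics.QuantumFieldTheory.Balaban1983to89
open Literature.MathematicalPhysics.QuantumFieldTheory.Balaban1983to89.T3ContinuumYM3Torus
open T3SectALandauChart (formComp bgUnits)
open B9Eq39Adjoint (curl posPlaq)
open B10Eq27TorusAxialLog (unitsField toUField)
open B9TorusCalculus (torusT)
open Summit.QuantumFields.YangMills.Theorems.Prop7SectET3HilbertLetters (W₂ frobEquiv)
open Summit.QuantumFields.YangMills.Theorems.Prop7RieszTauFrobNorm (norm_sq_frobEquiv_symm)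
open Summit.QuantumFields.YangMills.Theorems.Prop7LocalDivergenceComparison (sum_normSq_mul_le_opNorm_sq_mul sum_normSq_mul_le_mul_opNorm_sq sum_normSq_add_le)
open Summit.QuantumFields.YangMills.Theorems.Prop7CovariantCurlGaugeComparison (curl_apply)

/-! ## §1 The Frobenius row for two unitaries (transporter on the left) -/

/-- ★ **`Σ_{jk}|(VZV* − WZW*)_{jk}|² ≤ 4‖V − W‖²·Σ_{jk}|Z_{jk}|²`** for `V W ∈ SU(2)`: `VZV* − WZW* = (V − W)·(ZV*) + (WZ)·(V − W)*`, `‖V*‖ ≤ 1`, `‖W‖ ≤ 1`, `‖(V − W)*‖ = ‖V − W‖`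
(the case `W = 1` is w7 g11's ✓`Prop7CovariantCurlGaugeComparison.sum_normSq_mul_mul_star_sub_le`). [cite: Balaban1985Averaging, (18)–(20) p.21] -/
theorem sum_normSq_conjAd_sub_conjAd_le (V W : Matrix.specialUnitaryGroup (Fin 2) ℂ) (Z : Matrix (Fin 2) (Fin 2) ℂ) :
    ∑ j, ∑ k, ‖((V : Matrix (Fin 2) (Fin 2) ℂ) * Z * star (V : Matrix (Fin 2) (Fin 2) ℂ)
        - (W : Matrix (Fin 2) (Fin 2) ℂ) * Z * star (W : Matrix (Fin 2) (Fin 2) ℂ)) j k‖ ^ 2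
      ≤ 4 * ‖(V : Matrix (Fin 2) (Fin 2) ℂ) - (W : Matrix (Fin 2) (Fin 2) ℂ)‖ ^ 2 * ∑ j, ∑ k, ‖Z j k‖ ^ 2 := by
  set v : Matrix (Fin 2) (Fin 2) ℂ := (V : Matrix (Fin 2) (Fin 2) ℂ) with hv
  set w : Matrix (Fin 2) (Fin 2) ℂ := (W : Matrix (Fin 2) (Fin 2) ℂ) with hw
  have hid : v * Z * star v - w * Z * star w = (v - w) * (Z * star v) + (w * Z) * star (v - w) := by
    rw [star_sub]; noncomm_ring
  have hstarv : ‖star v‖ ≤ 1 := by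
    rw [Matrix.star_eq_conjTranspose, Matrix.l2_opNorm_conjTranspose]
    exact (CStarRing.norm_coe_unitary ⟨v, Matrix.specialUnitaryGroup_le_unitaryGroup V.2⟩).le
  have hwle : ‖w‖ ≤ 1 := (CStarRing.norm_coe_unitary ⟨w, Matrix.specialUnitaryGroup_le_unitaryGroup W.2⟩).le
  have hsd : ‖star (v - w)‖ = ‖v - w‖ := by
    rw [Matrix.star_eq_conjTranspose, Matrix.l2_opNorm_conjTranspose]
  have hZ : 0 ≤ ∑ j, ∑ k, ‖Z j k‖ ^ 2 := Finset.sum_nonneg fun j _ => Finset.sum_nonneg fun k _ => sq_nonneg _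
  have h1 : ∑ j, ∑ k, ‖((v - w) * (Z * star v)) j k‖ ^ 2 ≤ ‖v - w‖ ^ 2 * ∑ j, ∑ k, ‖Z j k‖ ^ 2 := by
    calc ∑ j, ∑ k, ‖((v - w) * (Z * star v)) j k‖ ^ 2
          ≤ ‖v - w‖ ^ 2 * ∑ j, ∑ k, ‖(Z * star v) j k‖ ^ 2 := sum_normSq_mul_le_opNorm_sq_mul _ _
      _ ≤ ‖v - w‖ ^ 2 * (1 * ∑ j, ∑ k, ‖Z j k‖ ^ 2) := by
          gcongr
          calc ∑ j, ∑ k, ‖(Z * star v) j k‖ ^ 2 ≤ ‖star v‖ ^ 2 * ∑ j, ∑ k, ‖Z j k‖ ^ 2 := sum_normSq_mul_le_mul_opNorm_sq _ _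
            _ ≤ 1 * ∑ j, ∑ k, ‖Z j k‖ ^ 2 := by
                refine mul_le_mul_of_nonneg_right ?_ hZ
                calc ‖star v‖ ^ 2 ≤ 1 ^ 2 := pow_le_pow_left₀ (norm_nonneg _) hstarv 2
                  _ = 1 := one_pow 2
      _ = ‖v - w‖ ^ 2 * ∑ j, ∑ k, ‖Z j k‖ ^ 2 := by rw [one_mul]
  have h2 : ∑ j, ∑ k, ‖((w * Z) * star (v - w)) j k‖ ^ 2 ≤ ‖v - w‖ ^ 2 * ∑ j, ∑ k, ‖Z j k‖ ^ 2 := by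
    calc ∑ j, ∑ k, ‖((w * Z) * star (v - w)) j k‖ ^ 2
          ≤ ‖star (v - w)‖ ^ 2 * ∑ j, ∑ k, ‖(w * Z) j k‖ ^ 2 := sum_normSq_mul_le_mul_opNorm_sq _ _
      _ ≤ ‖star (v - w)‖ ^ 2 * (1 * ∑ j, ∑ k, ‖Z j k‖ ^ 2) := by
          gcongr
          calc ∑ j, ∑ k, ‖(w * Z) j k‖ ^ 2 ≤ ‖w‖ ^ 2 * ∑ j, ∑ k, ‖Z j k‖ ^ 2 := sum_normSq_mul_le_opNorm_sq_mul _ _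
            _ ≤ 1 * ∑ j, ∑ k, ‖Z j k‖ ^ 2 := by
                refine mul_le_mul_of_nonneg_right ?_ hZ
                calc ‖w‖ ^ 2 ≤ 1 ^ 2 := pow_le_pow_left₀ (norm_nonneg _) hwle 2
                  _ = 1 := one_pow 2
      _ = ‖v - w‖ ^ 2 * ∑ j, ∑ k, ‖Z j k‖ ^ 2 := by rw [one_mul, hsd]
  calc ∑ j, ∑ k, ‖(v * Z * star v - w * Z * star w) j k‖ ^ 2
        = ∑ j, ∑ k, ‖((v - w) * (Z * star v) + (w * Z) * star (v - w)) j k‖ ^ 2 := by rw [hid]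
    _ ≤ 2 * ∑ j, ∑ k, ‖((v - w) * (Z * star v)) j k‖ ^ 2 + 2 * ∑ j, ∑ k, ‖((w * Z) * star (v - w)) j k‖ ^ 2 := sum_normSq_add_le _ _
    _ ≤ 2 * (‖v - w‖ ^ 2 * ∑ j, ∑ k, ‖Z j k‖ ^ 2) + 2 * (‖v - w‖ ^ 2 * ∑ j, ∑ k, ‖Z j k‖ ^ 2) := by gcongr
    _ = 4 * ‖v - w‖ ^ 2 * ∑ j, ∑ k, ‖Z j k‖ ^ 2 := by ring

/-! ## §2 The two-background curl stencil and its closeness on the adjacent-edge row -/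

section Closeness

variable {F : T3Family} {K : ℕ}

/-- **THE DIFFERENCE STENCIL FOR TWO BACKGROUNDS**: `((D¹_V − D¹_W)Y)(p_{μν}(x)) = (V(x,μ)Y_ν(x+e_μ)V(x,μ)* − W(x,μ)Y_ν(x+e_μ)W(x,μ)*) − (V(x,ν)Y_μ(x+e_ν)V(x,ν)* − W(x,ν)Y_μ(x+e_ν)W(x,ν)*)`
— the untransported letters `Y_ν(x)`, `Y_μ(x)` cancel; what is left is ZEROTH order in `Y`. [cite: Balaban1985BackgroundPropagators, (3.4) p.391] -/
theorem curl_sub_curl_apply (V W : GaugeField (F.P K) 0 (Matrix.specialUnitaryGroup (Fin 2) ℂ)) (Y : Fin (F.P K).d → Site (F.P K) 0 → Matrix (Fin 2) (Fin 2) ℂ)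
    (μ ν : Fin (F.P K).d) (x : Site (F.P K) 0) :
    curl (torusT (F.P K) 0) (fun κ z => unitsField (toUField V) ⟨z, κ⟩) Y μ ν x
        - curl (torusT (F.P K) 0) (fun κ z => unitsField (toUField W) ⟨z, κ⟩) Y μ ν x
      = ((V ⟨x, μ⟩ : Matrix (Fin 2) (Fin 2) ℂ) * Y ν (x.shift μ) * star (V ⟨x, μ⟩ : Matrix (Fin 2) (Fin 2) ℂ)
          - (W ⟨x, μ⟩ : Matrix (Fin 2) (Fin 2) ℂ) * Y ν (x.shift μ) * star (W ⟨x, μ⟩ : Matrix (Fin 2) (Fin 2) ℂ))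
        - ((V ⟨x, ν⟩ : Matrix (Fin 2) (Fin 2) ℂ) * Y μ (x.shift ν) * star (V ⟨x, ν⟩ : Matrix (Fin 2) (Fin 2) ℂ)
          - (W ⟨x, ν⟩ : Matrix (Fin 2) (Fin 2) ℂ) * Y μ (x.shift ν) * star (W ⟨x, ν⟩ : Matrix (Fin 2) (Fin 2) ℂ)) := by
  rw [curl_apply, curl_apply]
  abel

/-- ★★ **ZEROTH-ORDER CLOSENESS OF `D¹_V` TO `D¹_W` NEXT TO THE SUPPORT**: if `‖V(x,μ) − W(x,μ)‖ ≤ δ` for every edge `⟨x, μ⟩` ADJACENT to the support of `Y` (i.e. whenever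
`Y(x + e_μ, ν) ≠ 0` for some `ν ≠ μ`), then `Σ_{posPlaq} ‖((D¹_V − D¹_W)Y)(p)‖_F² ≤ 16·δ²·Σ_b‖Y_b‖_F²` (`16 = 2·4·(d − 1)`, `d = 3`; the count is ✓`curlSq_sub_le`'s, VERBATIM).
No hypothesis away from the support of `Y`, none on `W` (any background — at the use, a toron).
[cite: Balaban1985BackgroundPropagators, (3.4) p.391; Balaban1985RegularSpaces, Lemma 1 (1.25) p.79] -/
theorem curlSq_sub_curlSq_le (V W : GaugeField (F.P K) 0 (Matrix.specialUnitaryGroup (Fin 2) ℂ)) (Y : PBond (F.P K) 0 → Matrix (Fin 2) (Fin 2) ℂ) {δ : ℝ}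
    (hVW : ∀ (x : Site (F.P K) 0) (μ ν : Fin (F.P K).d), μ ≠ ν → Y ⟨x.shift μ, ν⟩ ≠ 0 →
      ‖(V ⟨x, μ⟩ : Matrix (Fin 2) (Fin 2) ℂ) - (W ⟨x, μ⟩ : Matrix (Fin 2) (Fin 2) ℂ)‖ ≤ δ) :
    ∑ q ∈ posPlaq (Site (F.P K) 0) (Fin (F.P K).d),
        ‖(frobEquiv.symm (curl (torusT (F.P K) 0) (fun μ x => bgUnits F K V ⟨x, μ⟩) (formComp Y) q.2.1 q.2.2 q.1
            - curl (torusT (F.P K) 0) (fun μ x => bgUnits F K W ⟨x, μ⟩) (formComp Y) q.2.1 q.2.2 q.1) : W₂)‖ ^ 2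
      ≤ 16 * δ ^ 2 * ∑ b : PBond (F.P K) 0, ∑ j, ∑ k, ‖Y b j k‖ ^ 2 := by
  have hd : (F.P K).d = 3 := rfl
  -- one transported slot: `Σ|VZV* − WZW*|² ≤ 4δ²Σ|Z|²` on the adjacent-edge row (trivial where `Z = 0`)
  have hslot : ∀ (x : Site (F.P K) 0) (μ ν : Fin (F.P K).d), μ ≠ ν →
      ∑ j, ∑ k, ‖((V ⟨x, μ⟩ : Matrix (Fin 2) (Fin 2) ℂ) * Y ⟨x.shift μ, ν⟩ * star (V ⟨x, μ⟩ : Matrix (Fin 2) (Fin 2) ℂ)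
          - (W ⟨x, μ⟩ : Matrix (Fin 2) (Fin 2) ℂ) * Y ⟨x.shift μ, ν⟩ * star (W ⟨x, μ⟩ : Matrix (Fin 2) (Fin 2) ℂ)) j k‖ ^ 2
        ≤ 4 * δ ^ 2 * ∑ j, ∑ k, ‖Y ⟨x.shift μ, ν⟩ j k‖ ^ 2 := by
    intro x μ ν hμν
    by_cases hY : Y ⟨x.shift μ, ν⟩ = 0
    · simp [hY]
    · calc _ ≤ 4 * ‖(V ⟨x, μ⟩ : Matrix (Fin 2) (Fin 2) ℂ) - (W ⟨x, μ⟩ : Matrix (Fin 2) (Fin 2) ℂ)‖ ^ 2 * ∑ j, ∑ k, ‖Y ⟨x.shift μ, ν⟩ j k‖ ^ 2 :=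
            sum_normSq_conjAd_sub_conjAd_le (V ⟨x, μ⟩) (W ⟨x, μ⟩) _
        _ ≤ 4 * δ ^ 2 * ∑ j, ∑ k, ‖Y ⟨x.shift μ, ν⟩ j k‖ ^ 2 := by
            have h1 : ‖(V ⟨x, μ⟩ : Matrix (Fin 2) (Fin 2) ℂ) - (W ⟨x, μ⟩ : Matrix (Fin 2) (Fin 2) ℂ)‖ ^ 2 ≤ δ ^ 2 :=
              pow_le_pow_left₀ (norm_nonneg _) (hVW x μ ν hμν hY) 2
            have h2 : 0 ≤ ∑ j, ∑ k, ‖Y ⟨x.shift μ, ν⟩ j k‖ ^ 2 := Finset.sum_nonneg fun j _ => Finset.sum_nonneg fun k _ => sq_nonneg _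
            nlinarith
  -- per plaquette `(x; μ, ν)`, `μ ≠ ν`
  have hplaq : ∀ (x : Site (F.P K) 0) (μ ν : Fin (F.P K).d), μ ≠ ν →
      ‖(frobEquiv.symm (curl (torusT (F.P K) 0) (fun μ x => bgUnits F K V ⟨x, μ⟩) (formComp Y) μ ν x
            - curl (torusT (F.P K) 0) (fun μ x => bgUnits F K W ⟨x, μ⟩) (formComp Y) μ ν x) : W₂)‖ ^ 2
        ≤ 8 * δ ^ 2 * (∑ j, ∑ k, ‖Y ⟨x.shift μ, ν⟩ j k‖ ^ 2) + 8 * δ ^ 2 * (∑ j, ∑ k, ‖Y ⟨x.shift ν, μ⟩ j k‖ ^ 2) := by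
    intro x μ ν hμν
    rw [norm_sq_frobEquiv_symm]
    have hcs := curl_sub_curl_apply V W (fun κ z => Y ⟨z, κ⟩) μ ν x
    -- `bgUnits = unitsField ∘ toUField`, `formComp Y κ z = Y ⟨z, κ⟩` (both by `rfl`)
    change ∑ j, ∑ k, ‖(curl (torusT (F.P K) 0) (fun κ z => unitsField (toUField V) ⟨z, κ⟩) (fun κ z => Y ⟨z, κ⟩) μ ν x
        - curl (torusT (F.P K) 0) (fun κ z => unitsField (toUField W) ⟨z, κ⟩) (fun κ z => Y ⟨z, κ⟩) μ ν x) j k‖ ^ 2 ≤ _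
    rw [hcs, sub_eq_add_neg]
    calc _ ≤ 2 * ∑ j, ∑ k, ‖((V ⟨x, μ⟩ : Matrix (Fin 2) (Fin 2) ℂ) * Y ⟨x.shift μ, ν⟩ * star (V ⟨x, μ⟩ : Matrix (Fin 2) (Fin 2) ℂ)
              - (W ⟨x, μ⟩ : Matrix (Fin 2) (Fin 2) ℂ) * Y ⟨x.shift μ, ν⟩ * star (W ⟨x, μ⟩ : Matrix (Fin 2) (Fin 2) ℂ)) j k‖ ^ 2
          + 2 * ∑ j, ∑ k, ‖(-((V ⟨x, ν⟩ : Matrix (Fin 2) (Fin 2) ℂ) * Y ⟨x.shift ν, μ⟩ * star (V ⟨x, ν⟩ : Matrix (Fin 2) (Fin 2) ℂ)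
              - (W ⟨x, ν⟩ : Matrix (Fin 2) (Fin 2) ℂ) * Y ⟨x.shift ν, μ⟩ * star (W ⟨x, ν⟩ : Matrix (Fin 2) (Fin 2) ℂ))) j k‖ ^ 2 :=
          sum_normSq_add_le _ _
      _ = 2 * ∑ j, ∑ k, ‖((V ⟨x, μ⟩ : Matrix (Fin 2) (Fin 2) ℂ) * Y ⟨x.shift μ, ν⟩ * star (V ⟨x, μ⟩ : Matrix (Fin 2) (Fin 2) ℂ)
              - (W ⟨x, μ⟩ : Matrix (Fin 2) (Fin 2) ℂ) * Y ⟨x.shift μ, ν⟩ * star (W ⟨x, μ⟩ : Matrix (Fin 2) (Fin 2) ℂ)) j k‖ ^ 2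
          + 2 * ∑ j, ∑ k, ‖((V ⟨x, ν⟩ : Matrix (Fin 2) (Fin 2) ℂ) * Y ⟨x.shift ν, μ⟩ * star (V ⟨x, ν⟩ : Matrix (Fin 2) (Fin 2) ℂ)
              - (W ⟨x, ν⟩ : Matrix (Fin 2) (Fin 2) ℂ) * Y ⟨x.shift ν, μ⟩ * star (W ⟨x, ν⟩ : Matrix (Fin 2) (Fin 2) ℂ)) j k‖ ^ 2 := by
          simp only [Matrix.neg_apply, norm_neg]
      _ ≤ 2 * (4 * δ ^ 2 * ∑ j, ∑ k, ‖Y ⟨x.shift μ, ν⟩ j k‖ ^ 2) + 2 * (4 * δ ^ 2 * ∑ j, ∑ k, ‖Y ⟨x.shift ν, μ⟩ j k‖ ^ 2) := by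
          gcongr
          · exact hslot x μ ν hμν
          · exact hslot x ν μ (Ne.symm hμν)
      _ = _ := by ring
  -- the plaquette∕bond count (✓`curlSq_sub_le`, verbatim): `Σ_{x, μ<ν}(S(x+e_μ,ν) + S(x+e_ν,μ)) = Σ_{x, μ≠ν} S(x+e_μ,ν) = (d−1)·Σ_b S_b`
  set S : Site (F.P K) 0 → Fin (F.P K).d → ℝ := fun y ν => ∑ j, ∑ k, ‖Y ⟨y, ν⟩ j k‖ ^ 2 with hS
  have hS0 : ∀ y ν, 0 ≤ S y ν := fun y ν => Finset.sum_nonneg fun j _ => Finset.sum_nonneg fun k _ => sq_nonneg _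
  have hstep1 : ∑ q ∈ posPlaq (Site (F.P K) 0) (Fin (F.P K).d),
        ‖(frobEquiv.symm (curl (torusT (F.P K) 0) (fun μ x => bgUnits F K V ⟨x, μ⟩) (formComp Y) q.2.1 q.2.2 q.1
            - curl (torusT (F.P K) 0) (fun μ x => bgUnits F K W ⟨x, μ⟩) (formComp Y) q.2.1 q.2.2 q.1) : W₂)‖ ^ 2
      ≤ ∑ q ∈ posPlaq (Site (F.P K) 0) (Fin (F.P K).d), 8 * δ ^ 2 * (S (q.1.shift q.2.1) q.2.2 + S (q.1.shift q.2.2) q.2.1) := by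
    refine Finset.sum_le_sum fun q hq => ?_
    have hμν : q.2.1 ≠ q.2.2 := ne_of_lt (Finset.mem_filter.mp hq).2
    have := hplaq q.1 q.2.1 q.2.2 hμν
    rw [hS]
    linarith
  have hx : ∀ x : Site (F.P K) 0, ∑ μ : Fin (F.P K).d, ∑ ν : Fin (F.P K).d, (if μ < ν then S (x.shift μ) ν + S (x.shift ν) μ else 0)
      = ∑ μ : Fin (F.P K).d, ∑ ν : Fin (F.P K).d, (if μ ≠ ν then S (x.shift μ) ν else 0) := by
    intro x
    have hA : ∑ μ : Fin (F.P K).d, ∑ ν : Fin (F.P K).d, (if μ < ν then S (x.shift μ) ν + S (x.shift ν) μ else 0)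
        = ∑ μ : Fin (F.P K).d, ∑ ν : Fin (F.P K).d, (if μ < ν then S (x.shift μ) ν else 0)
          + ∑ μ : Fin (F.P K).d, ∑ ν : Fin (F.P K).d, (if μ < ν then S (x.shift ν) μ else 0) := by
      rw [← Finset.sum_add_distrib]
      refine Finset.sum_congr rfl fun μ _ => ?_
      rw [← Finset.sum_add_distrib]
      refine Finset.sum_congr rfl fun ν _ => ?_
      split_ifs <;> simp
    have hB : ∑ μ : Fin (F.P K).d, ∑ ν : Fin (F.P K).d, (if μ < ν then S (x.shift ν) μ else 0)
        = ∑ μ : Fin (F.P K).d, ∑ ν : Fin (F.P K).d, (if ν < μ then S (x.shift μ) ν else 0) := Finset.sum_comm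
    rw [hA, hB, ← Finset.sum_add_distrib]
    refine Finset.sum_congr rfl fun μ _ => ?_
    rw [← Finset.sum_add_distrib]
    refine Finset.sum_congr rfl fun ν _ => ?_
    rcases lt_trichotomy μ ν with h | h | h
    · rw [if_pos h, if_neg (not_lt.mpr h.le), if_pos (ne_of_lt h), add_zero]
    · rw [if_neg (lt_irrefl _ ∘ (h ▸ ·)), if_neg (lt_irrefl _ ∘ (h ▸ ·)), if_neg (fun hne => hne h), add_zero]
    · rw [if_neg (not_lt.mpr h.le), if_pos h, if_pos (ne_of_lt h).symm, zero_add]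
  have hstep2 : ∑ q ∈ posPlaq (Site (F.P K) 0) (Fin (F.P K).d), (S (q.1.shift q.2.1) q.2.2 + S (q.1.shift q.2.2) q.2.1)
      = ∑ x : Site (F.P K) 0, ∑ μ : Fin (F.P K).d, ∑ ν : Fin (F.P K).d, (if μ ≠ ν then S (x.shift μ) ν else 0) := by
    rw [B9Eq39Adjoint.sum_posPlaq (fun (x : Site (F.P K) 0) (μ ν : Fin (F.P K).d) => S (x.shift μ) ν + S (x.shift ν) μ)]
    exact Finset.sum_congr rfl fun x _ => hx x
  have hstep3 : ∑ x : Site (F.P K) 0, ∑ μ : Fin (F.P K).d, ∑ ν : Fin (F.P K).d, (if μ ≠ ν then S (x.shift μ) ν else 0)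
      ≤ 2 * ∑ b : PBond (F.P K) 0, ∑ j, ∑ k, ‖Y b j k‖ ^ 2 := by
    have hre : ∀ μ ν : Fin (F.P K).d, ∑ x : Site (F.P K) 0, S (x.shift μ) ν = ∑ y : Site (F.P K) 0, S y ν := fun μ ν =>
      Fintype.sum_equiv (B10StarCount.shiftEquiv μ) (fun x => S (x.shift μ) ν) (fun y => S y ν) (fun _ => rfl)
    have hcomm : ∑ x : Site (F.P K) 0, ∑ μ : Fin (F.P K).d, ∑ ν : Fin (F.P K).d, (if μ ≠ ν then S (x.shift μ) ν else 0)
        = ∑ μ : Fin (F.P K).d, ∑ ν : Fin (F.P K).d, (if μ ≠ ν then ∑ y : Site (F.P K) 0, S y ν else 0) := by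
      rw [Finset.sum_comm]
      refine Finset.sum_congr rfl fun μ _ => ?_
      rw [Finset.sum_comm]
      refine Finset.sum_congr rfl fun ν _ => ?_
      split_ifs with h
      · exact hre μ ν
      · simp
    rw [hcomm]
    have hbond : ∑ b : PBond (F.P K) 0, ∑ j, ∑ k, ‖Y b j k‖ ^ 2 = ∑ ν : Fin (F.P K).d, ∑ y : Site (F.P K) 0, S y ν := by
      rw [B10StarCount.sum_pbond, Finset.sum_comm]
    rw [hbond]
    have hT0 : ∀ ν : Fin (F.P K).d, 0 ≤ ∑ y : Site (F.P K) 0, S y ν := fun ν => Finset.sum_nonneg fun y _ => hS0 y ν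
    rw [Finset.sum_comm, Finset.mul_sum]
    refine Finset.sum_le_sum fun ν _ => ?_
    have hcount : ∑ μ : Fin (F.P K).d, (if μ ≠ ν then ∑ y : Site (F.P K) 0, S y ν else 0)
        = ((Finset.univ.filter fun μ : Fin (F.P K).d => μ ≠ ν).card : ℝ) * ∑ y : Site (F.P K) 0, S y ν := by
      rw [← Finset.sum_filter, Finset.sum_const, nsmul_eq_mul]
    rw [hcount]
    have hcard : ((Finset.univ.filter fun μ : Fin (F.P K).d => μ ≠ ν).card : ℝ) = 2 := by
      have : (Finset.univ.filter fun μ : Fin (F.P K).d => μ ≠ ν).card = 2 := by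
        rw [Finset.filter_ne' Finset.univ ν, Finset.card_erase_of_mem (Finset.mem_univ ν), Finset.card_univ, Fintype.card_fin, hd]
      exact_mod_cast this
    rw [hcard]
  have hδ2 : 0 ≤ 8 * δ ^ 2 := by positivity
  calc _ ≤ ∑ q ∈ posPlaq (Site (F.P K) 0) (Fin (F.P K).d), 8 * δ ^ 2 * (S (q.1.shift q.2.1) q.2.2 + S (q.1.shift q.2.2) q.2.1) := hstep1
    _ = 8 * δ ^ 2 * ∑ q ∈ posPlaq (Site (F.P K) 0) (Fin (F.P K).d), (S (q.1.shift q.2.1) q.2.2 + S (q.1.shift q.2.2) q.2.1) := by rw [Finset.mul_sum]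
    _ ≤ 8 * δ ^ 2 * (2 * ∑ b : PBond (F.P K) 0, ∑ j, ∑ k, ‖Y b j k‖ ^ 2) := mul_le_mul_of_nonneg_left (hstep2.le.trans hstep3) hδ2
    _ = 16 * δ ^ 2 * ∑ b : PBond (F.P K) 0, ∑ j, ∑ k, ‖Y b j k‖ ^ 2 := by ring

end Closeness

end Summit.QuantumFields.YangMills.Theorems.Prop7TwoBackgroundCurlComparison

end
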